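import Mathlib
import Summits.ResolutionOfSingularities.ResolutionOfSingularities.Theorems.CleanModels.Negative.CossartPiltant2019Thm15iFrameOrdTowerCurveBlowups
import Summits.ResolutionOfSingularities.ResolutionOfSingularities.Theorems.CleanModels.Negative.CossartPiltant2019Thm15iFrameOrdTowerCurveResidues
import HarnessLib

/-!
# F-110 is FALSE: `¬ CossartPiltant2019_thm_1_5_i_frame` (unconditional)

Final file (INPUTS seat res-inputs-p-cp15frame g2, director KEY DR-IN5 (P)(ii), 2026-08-28) of the refutation of the RETIRED
statement F-110 `Literature.AlgebraicGeometry.CossartPiltant200819.CossartPiltant2019_thm_1_5_i_frame` — an OVER-READ of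
Cossart–Piltant 2019, Thm 1.5 (i) with Prop 2.22 (erratum in `Literature/AlgebraicGeometry/CossartPiltant200819/Thm15FrameSHE2019.lean`,
rulings res-B-crit-1 `VERDICT-F110-challenge.md` 4f8c22baff37bd88 and res-inputs-crit-1 R190; crux `CleanModels`,
stmt-ResolutionOfSingularities-15917; the printed theorem is fine and is `CossartPiltant2019Local`).

The chain of negative lemmas landed by g1 reduced `¬ F-110` to `CurveBlowupFacts 5`
(`CossartPiltant2019_thm_1_5_i_frame_false_of_curveBlowupFacts`): three facts about the curve blow-ups `B♯ = S[v/u₀]_{centre}` of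
`S = 𝔽₅[X₀,X₁,X₂]_{(X)}` along the divisorial valuation `O = ord_𝔪`.  They are now theorems:

* (a) regular parameters of `B♯` have order `1` — `OrdWitness.ordVK_eq_expNeg_one_of_mem_maximalIdeal_Bsharp` (`…OrdTowerCurveChartIdeal`,
  quasi-regularity of the regular system of parameters `(u₀, v, w)`, Matsumura 17.10);
* (b) residues of `B♯` that are `5`-th powers in `κ(O)` are `5`-th powers in `κ(B♯)` — `OrdWitness.exists_pow_of_Bsharp`
  (`…OrdTowerCurveResidues`, derivations `u₀∂_b` on `K`);
* (c) local blowing ups of `B♯` along regular centres are `B♯` or `O` — `OrdWitness.isLocalBlowupAlong_Bsharp` (`…OrdTowerCurveBlowups`,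
  Matsumura 14.2 with `dim B♯ ≤ 2`).

Hence `curveBlowupFacts : CurveBlowupFacts p` for every prime `p`, and the headline
**`CossartPiltant2019_thm_1_5_i_frame_false : ¬ CossartPiltant2019_thm_1_5_i_frame.{0}`** — sorry-free, no named fact, axioms
`propext`, `Classical.choice`, `Quot.sound`.  WITNESS (res-inputs-crit-1 R190 (3)): `p = 5`, `S = 𝔽₅[X₀,X₁,X₂]_{(X)}`, `f = X₀²X₁`,
`O = ord_𝔪`; every F-110 tower ends at `S`, a curve blow-up `B♯` or `O`, whose parameters all have order `1` and whose residue
fields are relatively `5`-closed in `κ(O)`, while the affine `K⁵`-line through `x²y` has no element of order `1`; so the last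
radicand is congruent to a `5`-th power modulo `𝔪²` and `B_n[X]/(X⁵ − g_n)` is never regular.

SECOND PROOF OF RECORD (DR-IN6/DR-IN7a): res-B-lens-6 g4 reached the same theorem independently and sorry-free in the crux
workfile `Cruxes/DescentPerfectToAll/Lines/not_f110_ordm.lean` (rev 7 dfd4539c1c8b, 2026-08-28T23:03Z; same witness, encoded with
`RatFunc`/the `X`-adic valuation; clause (b) there = `stub_fifthPower_coeff`, closed by a binary-form argument).  This file is the
(P)-line landing (path (i) of DR-IN7a); the two encodings do not share lemmas.

HONESTY: this refutes only the typed frame shape F-110 (its END clause (d) is stronger than print); it proves nothing about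
resolution of singularities in characteristic `p`, `CleanModels`, or rung B. [OURS · NEGATIVE] counted 0.
-/

noncomputable section

set_option linter.dupNamespace false -- mandated namespace of this single-conjunct summit

open MvPolynomial IsLocalRing
open Literature.AlgebraicGeometry.Resolution Literature.AlgebraicGeometry.Resolution.WeightedBlowup

namespace Summit.ResolutionOfSingularities.ResolutionOfSingularities.Theorems.CleanModels.Negative

namespace OrdWitness

variable (p : ℕ) [hp : Fact p.Prime]

/-- **Every curve blow-up is a `B♯`**: a curve blow-up `B` (`IsCurveBlowup`) equals `Bsharp p x` for a regular system of parameters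
`x = (u₀, v, w)` of `range (S → K)` with `(u₀, v)` its centre. [folklore] -/
theorem exists_eq_Bsharp_of_isCurveBlowup {B : Subring (K p)} (hC : IsCurveBlowup p B) :
    ∃ x : Fin 3 → Rg p, Ideal.span (Set.range x) = maximalIdeal (Rg p) ∧ B = Bsharp p x := by
  obtain ⟨P, hRP, hxP, hnp, -, u, u₀, hspan, hu₀, hne, hval, hB⟩ := hC
  obtain ⟨x, hx0, hx, hP⟩ := exists_rsop_of_curveCentre p hRP hxP hnp hspan hu₀ hne hval
  refine ⟨x, hx, ?_⟩
  have hne' : ((u₀ : Rg p) : K p) ≠ 0 := fun e => hne (Subtype.ext e)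
  have hP' : Ideal.span {u₀, x 1} = P := by rw [← hx0]; exact hP
  rw [hB]
  show _ = locAtCentre (Subring.closure ((Rg p : Set (K p)) ∪ {(x 1 : K p) / (x 0 : K p)})) (O p)
  rw [closure_div_eq_closure_singleton hspan hP' hne', hx0]

end OrdWitness

/-- **`CurveBlowupFacts p` holds for every prime `p`** (clauses (a), (b), (c) for `B♯ = Bsharp p x`). [folklore] -/
theorem curveBlowupFacts (p : ℕ) [Fact p.Prime] : CurveBlowupFacts p := by
  intro B hC hreg
  obtain ⟨x, hx, rfl⟩ := OrdWitness.exists_eq_Bsharp_of_isCurveBlowup p hC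
  haveI := hreg
  exact ⟨fun t ht ht2 => OrdWitness.ordVK_eq_expNeg_one_of_mem_maximalIdeal_Bsharp hx t ht ht2,
    fun u d _ hud => OrdWitness.exists_pow_of_Bsharp hx u d hud,
    fun P' B' hP' H => OrdWitness.isLocalBlowupAlong_Bsharp hx P' B' hP' H⟩

/-- `CurveBlowupFacts 5`. [folklore] -/
theorem curveBlowupFacts_five : @CurveBlowupFacts 5 ⟨Nat.prime_five⟩ := @curveBlowupFacts 5 ⟨Nat.prime_five⟩

/-- **F-110 is FALSE** (unconditional; no named fact): the typed «frame» reading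
`Literature.AlgebraicGeometry.CossartPiltant200819.CossartPiltant2019_thm_1_5_i_frame` of Cossart–Piltant 2019 Thm 1.5 (i) /
Prop 2.22 fails at `p = 5`, `S = 𝔽₅[X₀,X₁,X₂]_{(X)}`, `f = X₀²X₁`, `O = ord_𝔪` (res-inputs-crit-1 R190 (3); critic rulings res-B-crit-1
`VERDICT-F110-challenge.md` 4f8c22baff37bd88, res-inputs-crit-1 R190).  Composition of the landed chain
`…_false_of_criticalWitness ⟸ …_false_of_ordTowerShape ⟸ …_false_of_curveBlowupFacts` with `curveBlowupFacts_five`. [folklore] -/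
theorem CossartPiltant2019_thm_1_5_i_frame_false :
    ¬ Literature.AlgebraicGeometry.CossartPiltant200819.CossartPiltant2019_thm_1_5_i_frame.{0} :=
  CossartPiltant2019_thm_1_5_i_frame_false_of_curveBlowupFacts curveBlowupFacts_five

end Summit.ResolutionOfSingularities.ResolutionOfSingularities.Theorems.CleanModels.Negative

end
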